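import Literature.NumberTheory.EllipticCurves.HeegnerPointsTrustBaseProofs
import HarnessLib

/-!
# Route `AdditiveKolyvaginRoad`, crux KS′ `LevelKolyvaginSystemsAdditive` (item stmt-BirchSwinnertonDyer-21396): THE RAMIFIED TORIC
# HABITAT IS NEVER EMPTY — for every elliptic `E/ℚ` and every odd prime `p` there is an imaginary quadratic `K′` with `p ∥ d_{K′}`
# and every other bad prime of `E` split in `K′` (first step of crux card `ramified-toric-habitat`)
# (cell `pub/bsd-wall`, width seat `bsd-wall-akr-p2x-w4` g6; `--supports stmt-BirchSwinnertonDyer-21396`, helper)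

THEOREMS ONLY (no definition, no named fact, no `sorry`).  BSD is not proved by any of this; nothing about signs, toric periods or
quaternion algebras is claimed (the card's `SignLawSupercuspidal ∕ SignLawPrincipalSeries` are NOT touched).

THE POINT.  The crux-ideation card `Cruxes/LevelKolyvaginSystemsAdditive/Ideas/ramified-toric-habitat.md` (round 1, seat 2 g19) spends
the freedom of the auxiliary imaginary quadratic field at `p`: «choose `K′` with `p` RAMIFIED in `K′` (`p ∣ d_{K′}`) and every other
bad prime split» — in the sketch's currency (`RamifiedHabitatKuriharaSlotSketch.lean` §1) the predicate
`RamifiedToricHabitat.OtherBadPrimesSplit W p d := ∀ q prime, q ∣ N_W → q ≠ p → (q ≠ 2 → (d/q) = 1) ∧ (q = 2 → d ≡ 1 mod 8)` together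
with `IsImaginaryQuadratic K′`, `d_{K′} < −4`, `p ∣ d_{K′}`.  This file proves that such a `K′` EXISTS for every elliptic `W/ℚ` and
every odd prime `p`, with `d_{K′}` below any bound — the habitat analogue of the tree's
`exists_isImaginaryQuadratic_and_satisfiesHeegnerHypothesis` (Heegner habitat):

* `isTotallyComplex_and_discr_eq_neg_of_root_of_squarefree` — `d_K = −m` for `K ∋ θ`, `θ² + uθ + v = 0`, `u² − 4v = −m`, `m`
  SQUARE-FREE (the tree's `isTotallyComplex_and_discr_eq_neg_of_root` has `m` prime; same proof: `−m = disc(1, θ) = r² d_K` and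
  `r² ∣ m` forces `r = ±1`).
* `exists_ramifiedHabitat` — for `W/ℚ` elliptic, `p` an odd prime and any `n`: an imaginary quadratic field `K` (a `Type` with its
  `Field ∕ NumberField` structure) with `d_K = −p·q` for a prime `q ∉ {2, p}` — so `d_K` is odd, `p ∣ d_K`, `d_K < −n`, `d_K < −4` —
  and `OtherBadPrimesSplit W p d_K` VERBATIM (unfolded).  Construction: `N′ =` the prime-to-`p` part of `N_W`; Dirichlet
  (Mathlib `Nat.forall_exists_prime_gt_and_eq_mod`) gives a prime `q > max(n, p)` with `q ≡ −p⁻¹ (mod 8N′)`, so `8N′ ∣ pq + 1`;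
  `K = ℚ[X]/(X² − X + (pq+1)/4) = ℚ(√−pq)` (Mathlib `AdjoinRoot`); `d_K = −pq` by the first theorem; `−pq ≡ 1 (mod 8)` and
  `(−pq / ℓ) = (1/ℓ) = 1` at every odd `ℓ ∣ N′`, i.e. at every bad `ℓ ≠ p`.

HONEST FRAMING: E-side, unconditional; the habitat's NON-EMPTINESS only (the card's numerical table T3 checks signs on 24 curves; the
sign laws need Rohrlich's local root numbers, not in reach of the tree's `localRootNumber` at additive `2, 3`).  References (locators
only): [cite: Marcus2018, Ch. 2 Thm. 1; Ch. 3 Thm. 25] [cite: BurungaleCastellaSkinner2025, Lemma 5.2.3 (Dirichlet + CRT pattern)].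
-/

-- single-conjunct summit: `Summit.BirchSwinnertonDyer.BirchSwinnertonDyer.…` repeats the name by design
set_option linter.dupNamespace false
set_option autoImplicit false

noncomputable section

open scoped Classical

namespace Summit.BirchSwinnertonDyer.BirchSwinnertonDyer.Theorems.AdditiveKoly.RamifiedHabitat

open NumberField Polynomial Literature.NumberTheory.EllipticCurves Literature.NumberTheory.QuadraticFields

universe u

/-! ## §1 `d_K = −m` from a root of `X² + uX + v`, `u² − 4v = −m`, `m` square-free -/

/-- **`d_K = −m` for `K ∋ θ`, `θ² + uθ + v = 0`, `u² − 4v = −m` with `m > 0` square-free.**  If `[K : ℚ] = 2` and `θ ∈ K` is a root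
of `X² + uX + v ∈ ℤ[X]` of discriminant `u² − 4v = −m < 0` with `m` square-free, then `K` is totally complex and `d_K = −m`
(`−m = disc(1, θ) = r² d_K`, `r ∈ ℤ ∖ {0}`, and `r² ∣ m` forces `r = ±1`).  The tree's `isTotallyComplex_and_discr_eq_neg_of_root` is the
case `m` prime, same proof. [cite: Marcus2018, Ch. 2 Thm. 1] -/
theorem isTotallyComplex_and_discr_eq_neg_of_root_of_squarefree {K : Type u} [Field K] [NumberField K]
    (h2 : Module.finrank ℚ K = 2) {u v : ℤ} {m : ℕ} (hm : Squarefree m) (hm0 : 0 < m) (hd : u ^ 2 - 4 * v = -(m : ℤ))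
    {θ : K} (hrel : θ ^ 2 + (u : K) * θ + (v : K) = 0) :
    IsTotallyComplex K ∧ NumberField.discr K = -(m : ℤ) := by
  have hneg : u ^ 2 - 4 * v < 0 := by
    rw [hd, neg_lt_zero]
    exact_mod_cast hm0
  have hrelQ : θ ^ 2 + algebraMap ℚ K u * θ + algebraMap ℚ K v = 0 := by
    simpa using hrel
  have hnegQ : (u : ℚ) ^ 2 - 4 * (v : ℚ) < 0 := by exact_mod_cast hneg
  refine ⟨Quadratic.isTotallyComplex_of_quadratic hrelQ hnegQ, ?_⟩
  have hθ : θ ∉ Set.range (algebraMap ℚ K) := Quadratic.not_mem_range_of_quadratic hrelQ hnegQ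
  have hint : IsIntegral ℤ θ := by
    refine ⟨X ^ 2 + C u * X + C v, ?_, ?_⟩
    · rw [add_assoc]
      refine (monic_X_pow 2).add_of_left (lt_of_le_of_lt degree_linear_le ?_)
      rw [degree_X_pow]
      norm_num
    · rw [eval₂_add, eval₂_add, eval₂_pow, eval₂_mul, eval₂_C, eval₂_X, eval₂_C, eq_intCast,
        eq_intCast]
      exact hrel
  obtain ⟨r, -, h⟩ := Quadratic.exists_discr_basisOneSqrt_eq_sq_mul_discr h2 hθ hint
  rw [Quadratic.discr_basisOneSqrt_of_quadratic h2 hθ hrelQ] at h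
  have h' : u ^ 2 - 4 * v = r ^ 2 * NumberField.discr K := by exact_mod_cast h
  rw [hd] at h'
  -- `r² ∣ m` with `m` square-free forces `r = ±1`
  have hsq : Squarefree (m : ℤ) := Int.squarefree_natCast.mpr hm
  have hru : IsUnit r := hsq r ⟨-NumberField.discr K, by linear_combination (-1 : ℤ) * h'⟩
  have hr1 : r ^ 2 = 1 := by
    rcases Int.isUnit_iff.mp hru with rfl | rfl <;> norm_num
  rw [hr1, one_mul] at h'
  exact h'.symm

/-! ## §2 The ramified habitat is non-empty -/

/-- **THE RAMIFIED TORIC HABITAT IS NEVER EMPTY.**  For an elliptic `W/ℚ`, an ODD prime `p` and any `n`: there is an imaginary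
quadratic field `K` with `d_K = −p·q` for a prime `q ∉ {2, p}` (so `d_K` is odd, `p ∣ d_K` exactly once, `d_K < −n`, `d_K < −4`) in
which every bad prime `ℓ ≠ p` of `W` SPLITS: `(d_K / ℓ) = 1` for odd `ℓ ∣ N_W`, `ℓ ≠ p`, and `d_K ≡ 1 (mod 8)` (so also `ℓ = 2` if
`2 ∣ N_W`) — the card's `OtherBadPrimesSplit W p d_K` verbatim.  Dirichlet's theorem supplies `q ≡ −p⁻¹ (mod 8N′)`, `N′` the
prime-to-`p` part of `N_W`; `K = ℚ(√−pq) = ℚ[X]/(X² − X + (pq+1)/4)`. [cite: Marcus2018, Ch. 2 Thm. 1; Ch. 3 Thm. 25]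
[cite: BurungaleCastellaSkinner2025, Lemma 5.2.3 (Dirichlet + CRT pattern)] -/
theorem exists_ramifiedHabitat (W : WeierstrassCurve ℚ) [W.IsElliptic] (p : ℕ) [hp : Fact p.Prime] (hp2 : p ≠ 2) (n : ℕ) :
    ∃ (K : Type) (_ : Field K) (_ : NumberField K),
      IsImaginaryQuadratic K ∧
      (∃ q : ℕ, q.Prime ∧ q ≠ 2 ∧ q ≠ p ∧ NumberField.discr K = -((p * q : ℕ) : ℤ)) ∧
      Odd (NumberField.discr K) ∧ (p : ℤ) ∣ NumberField.discr K ∧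
      NumberField.discr K < -(n : ℤ) ∧ NumberField.discr K < -4 ∧
      ∀ q : ℕ, q.Prime → (q : ℤ) ∣ (W.conductorNorm ℤ : ℤ) → q ≠ p →
        (q ≠ 2 → jacobiSym (NumberField.discr K) q = 1) ∧ (q = 2 → NumberField.discr K % 8 = 1) := by
  have hpP : p.Prime := hp.out
  -- the prime-to-`p` part `N′` of the conductor and the modulus `8 N′`
  set N : ℕ := W.conductorNorm ℤ with hN
  have hN0 : N ≠ 0 := (W.conductorNorm_pos_holds).ne'
  set N' : ℕ := N / p ^ N.factorization p with hN'
  have hN'0 : N' ≠ 0 := (Nat.ordCompl_pos p hN0).ne'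
  have hcopN' : Nat.Coprime p N' := Nat.coprime_ordCompl hpP hN0
  have hcop8 : Nat.Coprime p 8 := by
    have : Nat.Coprime p 2 := (Nat.coprime_primes hpP Nat.prime_two).mpr hp2
    simpa using this.pow_right 3
  have hcop : Nat.Coprime p (8 * N') := Nat.Coprime.mul_right hcop8 hcopN'
  haveI : NeZero (8 * N') := ⟨mul_ne_zero (by norm_num) hN'0⟩
  -- Dirichlet: a prime `q > max n p` with `q ≡ -p⁻¹ (mod 8N′)`
  set up : (ZMod (8 * N'))ˣ := ZMod.unitOfCoprime p hcop with hup
  obtain ⟨q, hqn, hq, hqmod⟩ :=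
    Nat.forall_exists_prime_gt_and_eq_mod (q := 8 * N') (a := -((up⁻¹ : (ZMod (8 * N'))ˣ) : ZMod (8 * N')))
      (Units.isUnit _).neg (max n p)
  have hqn' : n < q := lt_of_le_of_lt (le_max_left _ _) hqn
  have hqp' : p < q := lt_of_le_of_lt (le_max_right _ _) hqn
  have hqp : q ≠ p := hqp'.ne'
  -- `8 N′ ∣ p q + 1`
  have hdvd : 8 * N' ∣ p * q + 1 := by
    rw [← ZMod.natCast_eq_zero_iff]
    push_cast
    rw [hqmod, ← ZMod.coe_unitOfCoprime p hcop, ← hup, mul_neg, Units.mul_inv, neg_add_cancel]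
  obtain ⟨k, hk⟩ := hdvd
  have hq2 : q ≠ 2 := by
    rintro rfl
    have : 2 ∣ p * 2 + 1 := (dvd_mul_right 2 4).trans ((dvd_mul_right 8 N').trans ⟨k, hk⟩)
    omega
  -- `K = ℚ[X]/(X² - X + 2 N′ k)`, `1 - 8 N′ k = -p q`
  have hkZ : ((p * q : ℕ) : ℤ) + 1 = 8 * N' * k := by exact_mod_cast hk
  obtain ⟨f, hf⟩ : ∃ f : ℚ[X],
      f = C 1 * X ^ 2 + C (-((1 : ℤ) : ℚ)) * X + C ((2 * N' * k : ℤ) : ℚ) := ⟨_, rfl⟩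
  have hfdeg : f.natDegree = 2 := by rw [hf]; exact natDegree_quadratic one_ne_zero
  have hf0 : f ≠ 0 := by
    intro h; rw [h, natDegree_zero] at hfdeg; exact absurd hfdeg (by norm_num)
  have hkQ : ((p * q : ℕ) : ℚ) + 1 = 8 * (N' : ℚ) * (k : ℚ) := by exact_mod_cast hk
  have hpq0 : (0 : ℚ) < ((p * q : ℕ) : ℚ) := by exact_mod_cast Nat.mul_pos hpP.pos hq.pos
  have hfirr : Irreducible f := by
    refine (irreducible_iff_roots_eq_zero_of_degree_le_three (by omega) (by omega)).mpr ?_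
    refine Multiset.eq_zero_of_forall_notMem fun r hr ↦ ?_
    rw [mem_roots hf0, IsRoot.def, eval, hf, eval₂_one_mul_X_sq_add] at hr
    push_cast at hr
    nlinarith [sq_nonneg (2 * r - 1)]
  haveI : Fact (Irreducible f) := ⟨hfirr⟩
  have hkroot : AdjoinRoot.root f * AdjoinRoot.root f - ((1 : ℤ) : AdjoinRoot f) * AdjoinRoot.root f +
      ((2 * N' * k : ℤ) : AdjoinRoot f) = 0 := by
    rw [← eval₂_one_mul_X_sq_add (AdjoinRoot.of f), ← hf]
    exact AdjoinRoot.eval₂_root f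
  have hrel : AdjoinRoot.root f ^ 2 + ((-1 : ℤ) : AdjoinRoot f) * AdjoinRoot.root f +
      ((2 * N' * k : ℤ) : AdjoinRoot f) = 0 := by
    push_cast at hkroot ⊢
    linear_combination hkroot
  have h2 := (AdjoinRoot.powerBasis hf0).finrank
  rw [AdjoinRoot.powerBasis_dim, hfdeg] at h2
  have h2' : Module.finrank ℚ (AdjoinRoot f) = 2 := by convert h2 using 2
  -- `d_K = -p q`
  have hsqf : Squarefree (p * q) :=
    (Nat.squarefree_mul ((Nat.coprime_primes hpP hq).mpr hqp.symm)).mpr ⟨hpP.squarefree, hq.squarefree⟩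
  have hd : (-1 : ℤ) ^ 2 - 4 * (2 * N' * k) = -((p * q : ℕ) : ℤ) := by linear_combination hkZ
  obtain ⟨htc, hdK⟩ := isTotallyComplex_and_discr_eq_neg_of_root_of_squarefree h2' hsqf
    (Nat.mul_pos hpP.pos hq.pos) hd hrel
  refine ⟨AdjoinRoot f, inferInstance, inferInstance, ⟨h2', htc⟩, ⟨q, hq, hq2, hqp, hdK⟩, ?_, ?_, ?_, ?_, ?_⟩
  · -- odd
    rw [hdK]
    have hpo : Odd p := hpP.odd_of_ne_two hp2
    have hqo : Odd q := hq.odd_of_ne_two hq2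
    have : Odd ((p * q : ℕ) : ℤ) := by exact_mod_cast hpo.mul hqo
    exact this.neg
  · -- `p ∣ d_K`
    rw [hdK]
    exact Dvd.dvd.neg_right ⟨q, by push_cast; ring⟩
  · -- `d_K < -n`
    rw [hdK]
    have : n < p * q := lt_of_lt_of_le hqn' (Nat.le_mul_of_pos_left q hpP.pos)
    omega
  · -- `d_K < -4`
    rw [hdK]
    have h3 : 3 ≤ p := by
      have := hpP.two_le
      omega
    have : 4 < p * q := by nlinarith [hpP.two_le]
    omega
  · -- the other bad primes split
    intro ℓ hℓ hℓN hℓp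
    have hℓN_nat : ℓ ∣ N := by rw [hN]; exact Int.natCast_dvd_natCast.mp hℓN
    -- `ℓ ∣ N′`
    have hℓN' : ℓ ∣ N' := by
      have h := Nat.ordCompl_dvd_ordCompl_of_dvd hℓN_nat p
      have hℓfac : ℓ.factorization p = 0 :=
        Nat.factorization_eq_zero_of_not_dvd fun hpl ↦ hℓp ((Nat.prime_dvd_prime_iff_eq hpP hℓ).mp hpl).symm
      rw [hℓfac, pow_zero, Nat.div_one] at h
      exact h
    have hℓdvd : (ℓ : ℤ) ∣ ((p * q : ℕ) : ℤ) + 1 := by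
      rw [hkZ]
      exact (Int.natCast_dvd_natCast.mpr hℓN').trans ⟨8 * k, by ring⟩
    refine ⟨fun hℓ2 ↦ ?_, fun hℓ2 ↦ ?_⟩
    · rw [hdK]
      have hmod : (-((p * q : ℕ) : ℤ)) % (ℓ : ℤ) = (1 : ℤ) % (ℓ : ℤ) := by
        have : (-((p * q : ℕ) : ℤ)) ≡ 1 [ZMOD (ℓ : ℤ)] := by
          rw [Int.modEq_iff_dvd]
          simpa [sub_neg_eq_add, add_comm] using hℓdvd
        exact this
      rw [jacobiSym.mod_left, hmod, ← jacobiSym.mod_left, jacobiSym.one_left]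
    · rw [hdK]
      have h8 : (8 : ℤ) ∣ ((p * q : ℕ) : ℤ) + 1 := by rw [hkZ]; exact ⟨N' * k, by ring⟩
      omega

end Summit.BirchSwinnertonDyer.BirchSwinnertonDyer.Theorems.AdditiveKoly.RamifiedHabitat

end
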